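import Summits.HubbardSuperconductivity.HubbardSuperconductivity.Theorems.ThermalWedgeTwSeededEnsembleEquivalenceROptimiserFloor
import Summits.HubbardSuperconductivity.HubbardSuperconductivity.Theorems.ThermalWedgeTwSeededEnsembleEquivalenceRSourcedPressureLimit
import Summits.HubbardSuperconductivity.HubbardSuperconductivity.Theorems.ThermalWedgeTwSeededEnsembleEquivalenceRSharpSectorEntropy
import Summits.HubbardSuperconductivity.HubbardSuperconductivity.Theorems.ThermalWedgeTwApproximatingHamiltonian
import Literature.MathematicalPhysics.QuantumLattice.DuhamelTwoPoint
import Literature.MathematicalPhysics.QuantumLattice.DuhamelEqualTimeBounds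
import Literature.MathematicalPhysics.QuantumLattice.GibbsLinearResponse

/-!
# Crux `TwSeededEnsembleEquivalenceR` (stmt-HubbardSuperconductivity-15581), line `cold-floor-collapse` (slug `Sketch`),
# skeleton v8 (block two-phase pinning) — registered stub `stub_pbSectorSelection`

Support file (`--supports stmt-HubbardSuperconductivity-15581`; sorry-free; no definition).
Penalised Peierls–Bogoliubov sector selection (abstract finite-dimensional).
-/

set_option linter.dupNamespace false

namespace Summit.HubbardSuperconductivity.HubbardSuperconductivity.Theorems.TwSeededEnsembleEquivalenceR.ColdFloorLine

open Matrix Filter Topology Finset Literature.MathematicalPhysics.QuantumLattice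
open Literature.Barriers.HubbardSuperconductivity Literature.Probability.LatticeModels
open scoped ComplexOrder Matrix.Norms.L2Operator

noncomputable section

/-! ### Helper lemmas (private, prefixed `pbs_`) -/

/-- A matrix preserving a grading commutes with every diagonal matrix whose entries are constant on
the grading classes (both act blockwise). [folklore] -/
private theorem pbs_commute_diagonal {m : Type*} [Fintype m] [DecidableEq m]
    (K : Matrix m m ℂ) (v : m → ℂ) (hv : ∀ i j, K i j ≠ 0 → v i = v j) :
    Commute K (diagonal v) := by
  change K * diagonal v = diagonal v * K
  ext i j
  rw [mul_diagonal, diagonal_mul]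
  by_cases h : K i j = 0
  · rw [h, mul_zero, zero_mul]
  · rw [← hv i j h, mul_comm]

/-- Entries of the Gibbs weight of `K + D` for a real diagonal `D = diag(d)` commuting with `K`:
`(e^{-β(K + D)})_{ij} = (e^{-βK})_{ij} e^{-β d_j}` (`e^{-β(K+D)} = e^{-βK} e^{-βD}` by Mathlib's
`Matrix.exp_add_of_commute`, and `e^{-βD}` is diagonal, `Matrix.exp_diagonal`). [folklore] -/
private theorem pbs_gibbsWeight_add_diagonal_apply {m : Type*} [Fintype m] [DecidableEq m]
    (β : ℝ) (K : Matrix m m ℂ) (d : m → ℝ)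
    (hc : Commute K (diagonal fun i => ((d i : ℝ) : ℂ))) (i j : m) :
    gibbsWeight β (K + diagonal fun i => ((d i : ℝ) : ℂ)) i j =
      gibbsWeight β K i j * (Real.exp (-(β * d j)) : ℂ) := by
  have hD : -(β : ℂ) • (diagonal fun i => ((d i : ℝ) : ℂ)) =
      diagonal fun i => ((-(β * d i) : ℝ) : ℂ) := by
    ext a b
    simp only [diagonal_apply, Matrix.smul_apply, smul_eq_mul]
    split_ifs <;> simp
  rw [gibbsWeight, gibbsWeight, smul_add,
    Matrix.exp_add_of_commute _ _ ((hc.smul_left _).smul_right _), hD, Matrix.exp_diagonal,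
    mul_diagonal, Pi.coe_exp, ← Complex.exp_eq_exp_ℂ, Complex.ofReal_exp]

/-- **Sector decomposition of the penalised partition function.** If `K` preserves the grading
`deg` then `Re Z₁(K + diag f(deg)) = Σ_{N ∈ deg(univ)} e^{-f(N)} W(N)` with the sector weights
`W(N) = Σ_{deg i = N} Re (e^{-K})_{ii}`. [folklore] -/
private theorem pbs_partitionFn_re_eq_sum {m : Type*} [Fintype m] [DecidableEq m] (deg : m → ℕ)
    (K : Matrix m m ℂ) (hdeg : ∀ i j, K i j ≠ 0 → deg i = deg j) (f : ℕ → ℝ) :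
    (partitionFn 1 (K + diagonal fun i => ((f (deg i) : ℝ) : ℂ))).re =
      ∑ N ∈ Finset.univ.image deg, Real.exp (-f N) *
        ∑ i ∈ (Finset.univ.filter fun i => deg i = N), (gibbsWeight 1 K i i).re := by
  have hc : Commute K (diagonal fun i => ((f (deg i) : ℝ) : ℂ)) :=
    pbs_commute_diagonal K _ fun i j hij => by rw [hdeg i j hij]
  rw [partitionFn, trace, Complex.re_sum]
  simp only [diag_apply, pbs_gibbsWeight_add_diagonal_apply 1 K (fun i => f (deg i)) hc, one_mul,
    Complex.re_mul_ofReal]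
  rw [← sum_fiberwise_of_maps_to (s := (univ : Finset m)) (t := univ.image deg) (g := deg)
    (fun i hi => mem_image_of_mem deg hi)]
  refine sum_congr rfl fun N _ => ?_
  rw [mul_sum]
  refine sum_congr rfl fun i hi => ?_
  rw [(mem_filter.1 hi).2, mul_comm]

/-- A finite sum is at most the number of terms times its largest term. [folklore] -/
private theorem pbs_exists_sum_le_card_mul {s : Finset ℕ} (hs : s.Nonempty) (φ : ℕ → ℝ) :
    ∃ N ∈ s, ∑ M ∈ s, φ M ≤ (s.card : ℝ) * φ N := by
  obtain ⟨N, hN, hmax⟩ := exists_max_image s φ hs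
  refine ⟨N, hN, ?_⟩
  have h := sum_le_card_nsmul s φ (φ N) hmax
  rwa [nsmul_eq_mul] at h

/-- The sector weights `W(N) = Σ_{deg i = N} Re (e^{-K})_{ii}` of a Hermitian `K` are positive on
the range of the grading (diagonal entries of the positive definite `e^{-K}`). [folklore] -/
private theorem pbs_sectorWeight_pos {m : Type*} [Fintype m] [DecidableEq m] (deg : m → ℕ)
    {K : Matrix m m ℂ} (hK : K.IsHermitian) {N : ℕ} (hN : N ∈ Finset.univ.image deg) :
    0 < ∑ i ∈ (Finset.univ.filter fun i => deg i = N), (gibbsWeight 1 K i i).re := by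
  obtain ⟨i₀, _, hi₀⟩ := mem_image.1 hN
  refine sum_pos (fun i _ => ?_) ⟨i₀, mem_filter.2 ⟨mem_univ _, hi₀⟩⟩
  exact (Complex.pos_iff.1 ((posDef_gibbsWeight 1 hK).diag_pos (i := i))).1

/-- **Penalised Peierls–Bogoliubov sector selection** (core form, penalty `f ∘ deg`): for Hermitian
`K` preserving the grading `deg`, any Hermitian trial `K̃` and any real penalty profile `f`,
`log Z(K̃) - Re⟨K - K̃⟩_{K̃} - Re⟨diag f(deg)⟩_{K̃} ≤ log #deg(univ) - f(N) + log W(N)` for some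
sector `N` in the range of `deg` (Peierls–Bogoliubov with `W = (K - K̃) + diag f(deg)`, the sector
decomposition of `Z(K + diag f(deg))`, and `Σ_N ≤ card · max_N`). [folklore] -/
private theorem pbs_core {m : Type*} [Fintype m] [DecidableEq m] [Nonempty m] (deg : m → ℕ)
    (K Kt : Matrix m m ℂ) (hK : K.IsHermitian) (hKt : Kt.IsHermitian)
    (hdeg : ∀ i j, K i j ≠ 0 → deg i = deg j) (f : ℕ → ℝ) :
    ∃ N ∈ Finset.univ.image deg,
      Real.log (partitionFn 1 Kt).re - (gibbsState 1 Kt (K - Kt)).re -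
          (gibbsState 1 Kt (diagonal fun i => ((f (deg i) : ℝ) : ℂ))).re ≤
        Real.log ((Finset.univ.image deg).card : ℝ) - f N +
          Real.log (∑ i ∈ (Finset.univ.filter fun i => deg i = N), (gibbsWeight 1 K i i).re) := by
  have hDh : (diagonal fun i => ((f (deg i) : ℝ) : ℂ)).IsHermitian :=
    isHermitian_diagonal_iff.2 fun i => isSelfAdjoint_iff.2 (Complex.conj_ofReal _)
  -- Peierls–Bogoliubov in logarithmic form with the perturbation `(K - K̃) + D`
  have hPB := log_partitionFn_sub_le_log_partitionFn_add hKt ((hK.sub hKt).add hDh) (1 : ℝ)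
  rw [one_mul, map_add, Complex.add_re, ← add_assoc, add_sub_cancel] at hPB
  -- sector decomposition and selection of the heaviest sector
  have hZsum := pbs_partitionFn_re_eq_sum deg K hdeg f
  have himg : (Finset.univ.image deg).Nonempty := univ_nonempty.image deg
  obtain ⟨N, hN, hle⟩ := pbs_exists_sum_le_card_mul himg fun N => Real.exp (-f N) *
    ∑ i ∈ (Finset.univ.filter fun i => deg i = N), (gibbsWeight 1 K i i).re
  refine ⟨N, hN, ?_⟩
  have hWpos := pbs_sectorWeight_pos deg hK hN
  have hcard : (0 : ℝ) < ((Finset.univ.image deg).card : ℝ) := Nat.cast_pos.2 (card_pos.2 himg)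
  have hpos : 0 < (partitionFn 1 (K + diagonal fun i => ((f (deg i) : ℝ) : ℂ))).re :=
    partitionFn_re_pos (hK.add hDh) 1
  have hlog := Real.log_le_log hpos (hZsum.le.trans hle)
  rw [Real.log_mul hcard.ne' (mul_pos (Real.exp_pos _) hWpos).ne',
    Real.log_mul (Real.exp_pos _).ne' hWpos.ne', Real.log_exp] at hlog
  linarith

/-- (registered stub `stub_pbSectorSelection` of skeleton v8; statement verbatim — see Lines/Sketch.lean for the docstring) -/
theorem stub_pbSectorSelection :
    ∀ (n : Type) [Fintype n] [DecidableEq n] [Nonempty n] (deg : n → ℕ) (K Kt : Matrix n n ℂ),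
      K.IsHermitian → Kt.IsHermitian → (∀ i j, K i j ≠ 0 → deg i = deg j) →
      ∀ (t c : ℝ), 0 ≤ t →
        ∃ N ∈ Finset.univ.image deg,
          Real.log (Matrix.partitionFn 1 Kt).re - (Matrix.gibbsState 1 Kt (K - Kt)).re -
              (Matrix.gibbsState 1 Kt (Matrix.diagonal fun i => ((t * ((deg i : ℝ) - c) ^ 2 : ℝ) : ℂ))).re ≤
            Real.log ((Finset.univ.image deg).card : ℝ) - t * ((N : ℝ) - c) ^ 2 +
              Real.log (∑ i ∈ (Finset.univ.filter fun i => deg i = N), (Matrix.gibbsWeight 1 K i i).re) := by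
  intro n _ _ _ deg K Kt hK hKt hdeg t c _
  exact pbs_core deg K Kt hK hKt hdeg fun N => t * ((N : ℝ) - c) ^ 2

end

end Summit.HubbardSuperconductivity.HubbardSuperconductivity.Theorems.TwSeededEnsembleEquivalenceR.ColdFloorLine
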